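import Summits.AtomisticToContinuum.HydrodynamicLimit.Theorems.BoxDissipativeWeakStrongFluxClosureEntGaussExpMoment
import HarnessLib

/-!
# Crux `FluxClosure` (stmt-AtomisticToContinuum-9902, route BoxDissipativeWeakStrong), line `registered`:
# the `χ²`-type exponential moment of a weighted sum of Gaussian velocity coordinates (sub-goal Gc)

Support file (`--supports stmt-AtomisticToContinuum-9902`) for the crux
`Summit.AtomisticToContinuum.HydrodynamicLimit.Theses.BoxDissipativeWeakStrong.FluxClosure`: the registered sub-goal
Gc `velMeasure_lintegral_exp_sqSum_le` of the entropy line for the kinetic stub K. Given the positions `q`, the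
velocities under a local Gibbs law are independent Maxwellians,
`velMeasure u₀ θ₀ q = ⊗ₐ N(u₀(qₐ), θ₀(qₐ)𝟙)`; for coefficients `c` and a coordinate `k` the weighted sum of peculiar
velocities `S = Σₐ cₐ (vₐₖ - u₀(qₐ)ₖ)` is a centred Gaussian of variance `V = Σₐ cₐ² θ₀(qₐ) ≤ θM Σₐ cₐ²`, and for
`4 t θM Σ cₐ² ≤ 1` (so `2tV ≤ 1/2`)

  `∫ exp(t S²) = (1 - 2tV)^{-1/2} ≤ exp(2tV) ≤ exp(2 t θM Σₐ cₐ²)`.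

The law of `S` is never identified; instead (Gaussian linearisation) `exp(t S²) = ∫ exp(√(2t) S g) N(0,1)(dg)`
(the `N(0,1)` moment generating function `lintegral_exp_mul_gaussianReal`, read backwards), Tonelli swaps the
two integrals, the `v`-integral of `exp(Σₐ bₐ (vₐₖ - u₀(qₐ)ₖ))` factorises over the product measure
(`lintegral_fin_nat_prod_eq_prod`) into the one-site linear moments `exp(θ₀(qₐ) bₐ²/2)` of the landed Ga file
(`entGa_lintegral_exp_lin_gaussMeasure`), which reassemble to `exp(t g² V) ≤ exp(t g² θM Σ cₐ²)`, and the
remaining `g`-integral is the `χ²` moment `∫ exp(a g²) N(0,1)(dg) = (1 - 2a)^{-1/2}`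
(`lintegral_exp_mul_sq_gaussianReal`, `a = t θM Σ cₐ² ≤ 1/4`); finally `(1 - x)^{-1/2} ≤ eˣ` on `[0, 1/2]`.

No definitions, no new facts. References: standard (Gaussian and `χ²` moment generating functions, e.g.
A. Gut, *An Intermediate Course in Probability* (2009), Ch. III; L. M. Leemis, *Mathematical Statistics* (2026),
p. 210); H. Spohn, *Large Scale Dynamics of Interacting Particles* (1991), Part I §2.3 (local Maxwellians).
-/

noncomputable section

namespace Summit.AtomisticToContinuum.HydrodynamicLimit.Theorems
namespace FluxClosureEnt

open scoped BigOperators Topology Classical MeasureTheory ProbabilityTheory InnerProductSpace ENNReal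
open Filter Set Function MeasureTheory ProbabilityTheory
open Literature.MathematicalPhysics.KineticTheory Literature.Analysis.FluidPDE

/-- The elementary inequality behind the `χ²` bound: for `0 ≤ x ≤ 1/2`, `(1 - x)^{-1/2} ≤ eˣ`
(`(1 - x) e^{2x} ≥ (1 - x)(1 + x)² = 1 + x (1 - x - x²) ≥ 1`). -/
theorem entGc_inv_sqrt_one_sub_le_exp {x : ℝ} (h0 : 0 ≤ x) (h1 : x ≤ 1 / 2) :
    (Real.sqrt (1 - x))⁻¹ ≤ Real.exp x := by
  refine entGa_inv_sqrt_le_exp (by linarith) ?_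
  have he : x + 1 ≤ Real.exp x := Real.add_one_le_exp x
  have h2 : Real.exp (2 * x) = Real.exp x ^ 2 := by
    rw [sq, ← Real.exp_add, two_mul]
  rw [h2]
  have h3 : (x + 1) ^ 2 ≤ Real.exp x ^ 2 := pow_le_pow_left₀ (by linarith) he 2
  have h4 : 0 ≤ 1 - x - x ^ 2 := by nlinarith [mul_le_mul_of_nonneg_left h1 h0]
  nlinarith [mul_le_mul_of_nonneg_left h3 (by linarith : (0 : ℝ) ≤ 1 - x), mul_nonneg h0 h4]

/-- **Product of one-site linear moments.** Under the velocity law given the positions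
`velMeasure u₀ θ₀ q = ⊗ₐ N(u₀(qₐ), θ₀(qₐ)𝟙)` (`θ₀ > 0`), for coefficients `b` and a coordinate `k`,
`∫ exp(Σₐ bₐ (vₐₖ - u₀(qₐ)ₖ)) = exp(Σₐ θ₀(qₐ) bₐ²/2)`: Tonelli over the product measure and the one-site Gaussian
moment generating function `entGa_lintegral_exp_lin_gaussMeasure`. [folklore] -/
theorem entGc_lintegral_exp_sum_lin_velMeasure (u₀ : T3 → V3) (θ₀ : T3 → ℝ) (hθ₀ : ∀ x, 0 < θ₀ x) {n : ℕ}
    (q : Fin n → T3) (k : Fin 3) (b : Fin n → ℝ) :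
    ∫⁻ v, ENNReal.ofReal (Real.exp (∑ a, b a * (v a k - u₀ (q a) k))) ∂(velMeasure u₀ θ₀ q) =
      ENNReal.ofReal (Real.exp (∑ a, θ₀ (q a) * b a ^ 2 / 2)) := by
  unfold velMeasure
  calc ∫⁻ v, ENNReal.ofReal (Real.exp (∑ a, b a * (v a k - u₀ (q a) k)))
        ∂(Measure.pi fun i => gaussMeasure (u₀ (q i)) (θ₀ (q i)))
      = ∫⁻ v, ∏ a, ENNReal.ofReal (Real.exp (b a * (v a k - u₀ (q a) k)))
          ∂(Measure.pi fun i => gaussMeasure (u₀ (q i)) (θ₀ (q i))) := by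
        refine lintegral_congr fun v => ?_
        rw [Real.exp_sum, ENNReal.ofReal_prod_of_nonneg fun a _ => (Real.exp_pos _).le]
    _ = ∏ a, ∫⁻ w, ENNReal.ofReal (Real.exp (b a * (w k - u₀ (q a) k))) ∂(gaussMeasure (u₀ (q a)) (θ₀ (q a))) :=
        lintegral_fin_nat_prod_eq_prod (fun i => gaussMeasure (u₀ (q i)) (θ₀ (q i)))
          (f := fun a w => ENNReal.ofReal (Real.exp (b a * (w k - u₀ (q a) k)))) fun a => by fun_prop
    _ = ∏ a, ENNReal.ofReal (Real.exp (θ₀ (q a) * b a ^ 2 / 2)) :=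
        Finset.prod_congr rfl fun a _ => entGa_lintegral_exp_lin_gaussMeasure (u₀ (q a)) (hθ₀ (q a)) k (b a)
    _ = ENNReal.ofReal (Real.exp (∑ a, θ₀ (q a) * b a ^ 2 / 2)) := by
        rw [Real.exp_sum, ENNReal.ofReal_prod_of_nonneg fun a _ => (Real.exp_pos _).le]

/-- **Gc: exponential moment of the square of a weighted sum of independent Gaussian velocity coordinates.**
Under `velMeasure u₀ θ₀ q = ⊗ₐ N(u₀(qₐ), θ₀(qₐ)𝟙)` with `0 < θ₀ ≤ θM`, for `t ≥ 0` with `4 t θM Σₐ cₐ² ≤ 1`,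
`∫ exp(t (Σₐ cₐ (vₐₖ - u₀(qₐ)ₖ))²) ≤ exp(2 t θM Σₐ cₐ²)` (the sum is `N(0, V)`, `V ≤ θM Σ cₐ²`, and
`(1 - 2tV)^{-1/2} ≤ e^{2tV}` for `2tV ≤ 1/2`; proof by Gaussian linearisation `exp(tS²) = ∫ exp(√(2t) S g) dN(0,1)(g)`,
Tonelli, the product of one-site linear moments, and the `χ²` moment of `N(0,1)`). [folklore] -/
theorem velMeasure_lintegral_exp_sqSum_le : ∀ {n : ℕ} (u₀ : T3 → V3) (θ₀ : T3 → ℝ) (θM : ℝ), (∀ x, 0 < θ₀ x) → (∀ x, θ₀ x ≤ θM) → ∀ (q : Fin n → T3) (c : Fin n → ℝ) (k : Fin 3) (t : ℝ), 0 ≤ t → 4 * t * θM * (∑ a, c a ^ 2) ≤ 1 → ∫⁻ v, ENNReal.ofReal (Real.exp (t * (∑ a, c a * (v a k - u₀ (q a) k)) ^ 2)) ∂(velMeasure u₀ θ₀ q) ≤ ENNReal.ofReal (Real.exp (2 * t * θM * ∑ a, c a ^ 2)) := by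
  intro n u₀ θ₀ θM hθ₀ hθM q c k t ht h4
  have hθMpos : 0 < θM := (hθ₀ 0).trans_le (hθM 0)
  have hC0 : 0 ≤ ∑ a, c a ^ 2 := Finset.sum_nonneg fun a _ => sq_nonneg (c a)
  have hA0 : 0 ≤ t * θM * ∑ a, c a ^ 2 := by positivity
  have hA4 : t * θM * ∑ a, c a ^ 2 ≤ 1 / 4 := by linarith
  have hr2 : Real.sqrt (2 * t) ^ 2 = 2 * t := Real.sq_sqrt (by linarith)
  -- Gaussian linearisation: `exp(t S²) = ∫ exp(√(2t) S g) N(0,1)(dg)`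
  have hHS : ∀ v : Fin n → V3,
      ENNReal.ofReal (Real.exp (t * (∑ a, c a * (v a k - u₀ (q a) k)) ^ 2)) =
        ∫⁻ g, ENNReal.ofReal (Real.exp (∑ a, (Real.sqrt (2 * t) * g * c a) * (v a k - u₀ (q a) k)))
          ∂(gaussianReal 0 1) := by
    intro v
    have hsum : ∀ g : ℝ, ∑ a, (Real.sqrt (2 * t) * g * c a) * (v a k - u₀ (q a) k) =
        (Real.sqrt (2 * t) * ∑ a, c a * (v a k - u₀ (q a) k)) * g := by
      intro g
      rw [Finset.mul_sum, Finset.sum_mul]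
      exact Finset.sum_congr rfl fun a _ => by ring
    simp_rw [hsum]
    rw [lintegral_exp_mul_gaussianReal, mul_pow, hr2]
    congr 2
    ring
  have hFm : Measurable fun p : (Fin n → V3) × ℝ =>
      ENNReal.ofReal (Real.exp (∑ a, (Real.sqrt (2 * t) * p.2 * c a) * (p.1 a k - u₀ (q a) k))) := by
    fun_prop
  calc ∫⁻ v, ENNReal.ofReal (Real.exp (t * (∑ a, c a * (v a k - u₀ (q a) k)) ^ 2)) ∂(velMeasure u₀ θ₀ q)
      = ∫⁻ v, ∫⁻ g, ENNReal.ofReal (Real.exp (∑ a, (Real.sqrt (2 * t) * g * c a) * (v a k - u₀ (q a) k)))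
          ∂(gaussianReal 0 1) ∂(velMeasure u₀ θ₀ q) := lintegral_congr fun v => hHS v
    _ = ∫⁻ g, ∫⁻ v, ENNReal.ofReal (Real.exp (∑ a, (Real.sqrt (2 * t) * g * c a) * (v a k - u₀ (q a) k)))
          ∂(velMeasure u₀ θ₀ q) ∂(gaussianReal 0 1) := lintegral_lintegral_swap hFm.aemeasurable
    _ = ∫⁻ g, ENNReal.ofReal (Real.exp (∑ a, θ₀ (q a) * (Real.sqrt (2 * t) * g * c a) ^ 2 / 2))
          ∂(gaussianReal 0 1) :=
        lintegral_congr fun g => entGc_lintegral_exp_sum_lin_velMeasure u₀ θ₀ hθ₀ q k _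
    _ ≤ ∫⁻ g, ENNReal.ofReal (Real.exp ((t * θM * ∑ a, c a ^ 2) * g ^ 2)) ∂(gaussianReal 0 1) := by
        refine lintegral_mono fun g => ENNReal.ofReal_le_ofReal (Real.exp_le_exp.2 ?_)
        calc ∑ a, θ₀ (q a) * (Real.sqrt (2 * t) * g * c a) ^ 2 / 2
            ≤ ∑ a, θM * (Real.sqrt (2 * t) * g * c a) ^ 2 / 2 :=
              Finset.sum_le_sum fun a _ => by
                rw [mul_div_assoc, mul_div_assoc]
                exact mul_le_mul_of_nonneg_right (hθM (q a)) (by positivity)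
          _ = (t * θM * ∑ a, c a ^ 2) * g ^ 2 := by
              rw [Finset.mul_sum, Finset.sum_mul]
              refine Finset.sum_congr rfl fun a _ => ?_
              rw [show (Real.sqrt (2 * t) * g * c a) ^ 2 = Real.sqrt (2 * t) ^ 2 * g ^ 2 * c a ^ 2 by ring,
                hr2]
              ring
    _ = ENNReal.ofReal ((Real.sqrt (1 - 2 * (t * θM * ∑ a, c a ^ 2)))⁻¹) := by
        have h1 := lintegral_exp_mul_sq_gaussianReal (a := t * θM * ∑ a, c a ^ 2) (by linarith)
        rw [Real.rpow_neg (by linarith : (0 : ℝ) ≤ 1 - 2 * (t * θM * ∑ a, c a ^ 2)),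
          ← Real.sqrt_eq_rpow] at h1
        exact h1
    _ ≤ ENNReal.ofReal (Real.exp (2 * t * θM * ∑ a, c a ^ 2)) := by
        refine ENNReal.ofReal_le_ofReal ?_
        rw [show 2 * t * θM * ∑ a, c a ^ 2 = 2 * (t * θM * ∑ a, c a ^ 2) by ring]
        exact entGc_inv_sqrt_one_sub_le_exp (by linarith) (by linarith)

end FluxClosureEnt
end Summit.AtomisticToContinuum.HydrodynamicLimit.Theorems

end
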